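import Mathlib
import Literature.Combinatorics.Additive.BorderTricoloredSumFree
import Literature.Combinatorics.Additive.TricoloredSumFreeBound
import HarnessLib

/-!
# XyzFreeDiagonal

Topic `Literature/Computability/AlgebraicComplexity`. Named literature fact(s) relocated by the gate from `Summits/MatrixMultiplication/MatrixMultiplication/Theorems/SoloInformedCwTwoBoundedExponent.lean`
(accept-time relocation of `[cite]`d propositions written inline in a Summits proposal; human ruling 2026-08-15).
Sources: Strassen1991.

* `Literature.Computability.AlgebraicComplexity.XyzFreeDiagonalHypothesis`
-/

namespace Literature.Computability.AlgebraicComplexity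

open scoped BigOperators
open Filter Topology
open Literature.Combinatorics.Additive

/-- STRASSEN'S FREE-DIAGONAL THEOREM FOR `S₁`, as a hypothesis (self-contained statement):
`S₁ ⊂ {0,1,2}³` (the permutations of `(0,1,2)`) is tight with uniform marginals, so its asymptotic
subrank is `3`: for every `0 < η < 1`, every `S_K` with `|K|` large contains a free diagonal `D`
(a family of transversal triples such that the only transversal `(x₁, y₂, z₃)` with `x, y, z ∈ D` has
`x = y = z`) of size `≥ (3-η)^{|K|}` (Strassen 1991, via the Coppersmith–Winograd method; stated as
Christandl–Vrana–Zuiddam, arXiv:1709.07851 Thm. 4.4, with `P` uniform on `S₁`). Not yet proved in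
the tree; used below as an explicit hypothesis. See `xyzFreeDiagonalHypothesis_iff`.
[cite: Strassen1991, asymptotic subrank of tight sets with uniform marginals (as stated in ChristandlVranaZuiddam2023 Thm. 4.4, arXiv numbering)]
[file Computability/AlgebraicComplexity/XyzFreeDiagonal] -/
def XyzFreeDiagonalHypothesis : Prop :=
  ∀ η : ℝ, 0 < η → η < 1 → ∃ k₀ : ℕ, ∀ (K : Type) [Fintype K] [DecidableEq K],
    k₀ ≤ Fintype.card K →
      ∃ D : Finset ((K → Fin 3) × (K → Fin 3) × (K → Fin 3)),
        (∀ x ∈ D, ∀ k, x.1 k ≠ x.2.1 k ∧ x.1 k ≠ x.2.2 k ∧ x.2.1 k ≠ x.2.2 k) ∧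
        (∀ x ∈ D, ∀ y ∈ D, ∀ z ∈ D,
          (∀ k, x.1 k ≠ y.2.1 k ∧ x.1 k ≠ z.2.2 k ∧ y.2.1 k ≠ z.2.2 k) → x = y ∧ y = z) ∧
        (3 - η) ^ Fintype.card K ≤ (D.card : ℝ)

end Literature.Computability.AlgebraicComplexity
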